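import Literature.RepresentationTheory.HeisenbergGroup.SchrodingerSiegelFunctional
import Literature.RepresentationTheory.HeisenbergGroup.SchrodingerIsotropicEigenfunctional
import HarnessLib

/-!
# The β-normalised lift `e(v) = (v, ½ β v₁ v₂)` of a vector into Weil's Heisenberg group and the functional `Φ ↦ (M Φ)(0)`
# of an implementer carrying it into the Lagrangian `0 × Y`

Topic `RepresentationTheory/HeisenbergGroup`; namespace `Literature.RepresentationTheory.HeisenbergGroup`.  THEOREMS ONLY (no definition, no
instance, no notation, no named fact, no `sorry`).  Setting of ★ `SchrodingerSiegelFunctional` §1: a pairing `β : X →ₗ Y →ₗ R` (`2` invertible in `R`),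
Weil's Heisenberg group `Heisenberg (polar β)` with law `(v,t)(v′,t′) = (v+v′, t+t′+β v₁ v′₂)` (★ `HeisenbergGroup`: `polar β (x,y) (x′,y′) = β x y′`),
Weil's section `ofSymplectic : Sp(W) →* B₀(W)`, `σ ↦ (σ, f_σ)` with the second-degree character `f_σ(w) = ½(β(σw)₁(σw)₂ − β w₁ w₂)`
(★ `SchrodingerSiegelParabolic`), the smooth Schrödinger model `ρ = schrodingerSB β ψ` on `𝒮(X)` and MVW's group of pairs `S̃p_ψ = MpPsi ρ`
(★ `LocalWeilProjective`, `ImplementerCocycle`: `MpPsi.toRep`).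

THE POINT (recorded here because the cell's N3 (b) D-road — «the `Δ′ ⊗ W`-coinvariant functional `λ′ = ev₀ ∘ r(δ′) ∘ ω^𝔻(w₀)`», F0∕P2, crux H413, road
`F0/P2/B-p18/g28/N3-ROAD.v2.B-p18g28.md` §2 (D3) — consumes it): for a symplectic `σ` carrying a vector `v` INTO the Lagrangian `0 × Y`, `σ v = (0, y′)`,
Weil's section does NOT preserve the central component of a raw element `(v, τ)`:
**`(ofSymplectic σ)·(v, τ) = ((0, y′), τ − ½ β v₁ v₂)`** (`act_ofSymplectic_mk_of_apply_eq`) — the correction `β v₁ v₂` vanishes for `v ∈ 0 × Y`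
(★ `act_ofSymplectic_inY_eq`) but NOT for a vector of an isotropic subspace in general position (e.g. the realification of a hermitian-isotropic line:
`β v₁ v₂ = aᵀ T₀ b ≠ 0` in general).  The element that IS carried to `((0, y′), 0) = inY y′` is the β-NORMALISED lift **`e(v) := (v, ½ β v₁ v₂)`**
(`act_ofSymplectic_mk_half_of_apply_eq`, over ★ `SchrodingerIsotropicEigenfunctional.act_ofSymplectic_mk_half` ∕ `Heisenberg.mk_half_mul_mk_half`: `e` is MVW's parametrisation of `H(W)`, a homomorphism on every `alt(polar β)`-isotropic subspace).
Consequently, for any implementer `p = (σ, M) ∈ S̃p_ψ` and any such `v`: **`(M (ρ(e(v)) Φ))(0) = (M Φ)(0)`** (`apply_zero_toRep_schrodingerSB_mk_half`) —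
the functional `Φ ↦ (M Φ)(0)` is invariant under `ρ(e(v))` for every `v ∈ σ⁻¹(0 × Y)`, i.e. it is the `σ⁻¹(0 × Y)`-COINVARIANT functional in the
normalisation in which the twisted kernel is `span {ρ(e(v)) Φ − Φ}`; and for a RAW element the defect is the explicit character
`(M (ρ(v, τ) Φ))(0) = ψ(τ − ½ β v₁ v₂) · (M Φ)(0)` (`apply_zero_toRep_schrodingerSB_mk`).  Non-vanishing: `Φ ↦ (M Φ)(0)` is non-zero as soon as SOME test
function does not vanish at `0` (`exists_apply_zero_toRep_ne_zero`).  HC_CM is proved only modulo the printed citations until rung 0 closes; this file is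
generic Heisenberg-group algebra and introduces no debt.

## References
* [Weil1964] A. Weil, *Sur certains groupes d'opérateurs unitaires*, Acta Math. 111 (1964), n° 4 (4) p. 149 (`A(G)`), n° 5 (5) pp. 149–151 (`B₀(G)`, `f_σ`).
* [MoeglinVignerasWaldspurger1987] C. Mœglin, M.-F. Vignéras, J.-L. Waldspurger, LNM 1291 (1987), Chap. 2 I.1–I.4 (`H(W)`, the Schrödinger model),
  II.1 (A)–(B) (`S̃p_ψ`), II.6 (evaluation at `0` on the Siegel parabolic).
-/

set_option autoImplicit false

noncomputable section

namespace Literature.RepresentationTheory.HeisenbergGroup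

open Literature.NumberTheory.Automorphic

universe u v

/-! ## §1 Weil's section on raw and on β-normalised elements -/

section Algebra

variable {R : Type u} [CommRing R] {X Y : Type v} [AddCommGroup X] [Module R X] [AddCommGroup Y] [Module R Y]
  {β : X →ₗ[R] Y →ₗ[R] R}

/-- **Weil's section on a RAW element carried into `0 × Y`**: if `σ v = (0, y′)` then `(ofSymplectic σ)·(v, τ) = ((0, y′), τ − ½ β v₁ v₂)` — the central
component DROPS by `½ β v₁ v₂` (the second-degree character `f_σ(v) = ½(β(σv)₁(σv)₂ − β v₁ v₂)` with `β 0 y′ = 0`).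
[cite: Weil1964, n° 5 (5) pp. 149–151] -/
theorem act_ofSymplectic_mk_of_apply_eq [Invertible (2 : R)] (σ : symplecticGroup (polar β)) {v : X × Y} {y' : Y}
    (hv : σ.1 v = ((0 : X), y')) (τ : R) :
    (ofSymplectic (polar β) σ).act ⟨v, τ⟩ = ⟨((0 : X), y'), τ - ⅟(2 : R) * β v.1 v.2⟩ := by
  apply Heisenberg.ext
  · show (ofSymplectic (polar β) σ).σ v = ((0 : X), y')
    rw [ofSymplectic_σ]
    exact hv
  · show τ + (ofSymplectic (polar β) σ).f v = τ - ⅟(2 : R) * β v.1 v.2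
    rw [ofSymplectic_f, hv, polar_apply, polar_apply, map_zero, LinearMap.zero_apply, zero_sub, mul_neg, ← sub_eq_add_neg]

/-- **Weil's section on the β-NORMALISED lift carried into `0 × Y`**: if `σ v = (0, y′)` then `(ofSymplectic σ)·e(v) = inY y′` with
`e(v) = (v, ½ β v₁ v₂)` — no central defect (★ `act_ofSymplectic_mk_half`: `σ·e(v) = e(σ v)`, and `β 0 y′ = 0`; ★ `act_ofSymplectic_inY_eq` is the case
`v ∈ 0 × Y`). [cite: Weil1964, n° 5 (5) pp. 149–151] [cite: MoeglinVignerasWaldspurger1987, Chap. 2 II.6] -/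
theorem act_ofSymplectic_mk_half_of_apply_eq [Invertible (2 : R)] (σ : symplecticGroup (polar β)) {v : X × Y} {y' : Y}
    (hv : σ.1 v = ((0 : X), y')) :
    (ofSymplectic (polar β) σ).act ⟨v, ⅟(2 : R) * β v.1 v.2⟩ = inY β y' := by
  rw [← polar_apply β v v, act_ofSymplectic_mk_half, hv, polar_apply, map_zero, LinearMap.zero_apply, mul_zero]
  rfl

end Algebra

/-! ## §2 The functional `Φ ↦ (M Φ)(0)` of an implementer -/

section Functional

variable {R : Type u} [CommRing R] [TopologicalSpace R] {X Y : Type v} [AddCommGroup X] [Module R X] [AddCommGroup Y]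
  [Module R Y] [TopologicalSpace X] [IsTopologicalAddGroup X]
  {β : X →ₗ[R] Y →ₗ[R] R} {ψ : AddChar R Circle} (hl : IsLocallyConstant (⇑ψ : R → Circle))
  (hb : ∀ y : Y, Continuous fun u : X => β u y)

/-- `(ρ(inY y) Φ)(0) = Φ(0)` for the smooth Schrödinger model of ANY pairing `β` (`ψ(0 + β 0 y) = 1`; ★ `apply_zero_schrodingerSB_inY` is the Gram-matrix case).
[cite: MoeglinVignerasWaldspurger1987, Chap. 2 II.6] -/
theorem apply_zero_schrodingerSB_inY' (y : Y) (f : SchwartzBruhat X) :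
    ((schrodingerSB β ψ hl hb (inY β y) f : SchwartzBruhat X) : X → ℂ) 0 = (f : X → ℂ) 0 := by
  rw [schrodingerSB_apply]
  simp only [inY_t, inY_v, map_zero, LinearMap.zero_apply, AddChar.map_zero_eq_one, Circle.coe_one, one_mul, add_zero]

/-- the value at `0` after a RAW element: `(ρ(v, τ) Φ)(0) = ψ(τ) · Φ(v₁)`. [cite: MoeglinVignerasWaldspurger1987, Chap. 2 I.4] -/
theorem apply_zero_schrodingerSB_mk (v : X × Y) (τ : R) (f : SchwartzBruhat X) :
    ((schrodingerSB β ψ hl hb ⟨v, τ⟩ f : SchwartzBruhat X) : X → ℂ) 0 = (ψ τ : ℂ) * (f : X → ℂ) v.1 := by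
  rw [schrodingerSB_apply]
  simp only [map_zero, LinearMap.zero_apply, add_zero, zero_add]

variable [Invertible (2 : R)]

/-- **INVARIANCE OF `Φ ↦ (M Φ)(0)` UNDER THE NORMALISED LIFT**: for an implementer `p = (σ, M) ∈ S̃p_ψ` and a vector `v` with `σ v = (0, y′)`,
`(M (ρ(e(v)) Φ))(0) = (M Φ)(0)`, `e(v) = (v, ½ β v₁ v₂)` (`M ρ(h) = ρ(σ·h) M` and `σ·e(v) = inY y′`). [cite: MoeglinVignerasWaldspurger1987, Chap. 2 II.1 (A), II.6] -/
theorem apply_zero_toRep_schrodingerSB_mk_half (p : MpPsi (schrodingerSB β ψ hl hb)) {v : X × Y} {y' : Y}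
    (hv : ((p : symplecticGroup (polar β) × (SchwartzBruhat X ≃ₗ[ℂ] SchwartzBruhat X)).1).1 v = ((0 : X), y')) (f : SchwartzBruhat X) :
    ((MpPsi.toRep (schrodingerSB β ψ hl hb) p (schrodingerSB β ψ hl hb ⟨v, ⅟(2 : R) * β v.1 v.2⟩ f) : SchwartzBruhat X) : X → ℂ) 0 =
      ((MpPsi.toRep (schrodingerSB β ψ hl hb) p f : SchwartzBruhat X) : X → ℂ) 0 := by
  have himp := MpPsi.toRep_implements (schrodingerSB β ψ hl hb) p ⟨v, ⅟(2 : R) * β v.1 v.2⟩ f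
  rw [MpPsi.toOp_apply] at himp
  rw [MpPsi.toRep_apply, MpPsi.toRep_apply, himp, act_ofSymplectic_mk_half_of_apply_eq _ hv, apply_zero_schrodingerSB_inY']

/-- **THE DEFECT FOR A RAW ELEMENT**: `(M (ρ(v, τ) Φ))(0) = ψ(τ − ½ β v₁ v₂) · (M Φ)(0)` when `σ v = (0, y′)` — so `Φ ↦ (M Φ)(0)` is `ρ(v, τ)`-invariant iff
`ψ(τ − ½ β v₁ v₂) = 1`. [cite: Weil1964, n° 5 (5) pp. 149–151] [cite: MoeglinVignerasWaldspurger1987, Chap. 2 II.6] -/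
theorem apply_zero_toRep_schrodingerSB_mk (p : MpPsi (schrodingerSB β ψ hl hb)) {v : X × Y} {y' : Y}
    (hv : ((p : symplecticGroup (polar β) × (SchwartzBruhat X ≃ₗ[ℂ] SchwartzBruhat X)).1).1 v = ((0 : X), y')) (τ : R) (f : SchwartzBruhat X) :
    ((MpPsi.toRep (schrodingerSB β ψ hl hb) p (schrodingerSB β ψ hl hb ⟨v, τ⟩ f) : SchwartzBruhat X) : X → ℂ) 0 =
      (ψ (τ - ⅟(2 : R) * β v.1 v.2) : ℂ) * ((MpPsi.toRep (schrodingerSB β ψ hl hb) p f : SchwartzBruhat X) : X → ℂ) 0 := by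
  have himp := MpPsi.toRep_implements (schrodingerSB β ψ hl hb) p ⟨v, τ⟩ f
  rw [MpPsi.toOp_apply] at himp
  rw [MpPsi.toRep_apply, MpPsi.toRep_apply, himp, act_ofSymplectic_mk_of_apply_eq _ hv, apply_zero_schrodingerSB_mk]

omit [IsTopologicalAddGroup X] [Invertible (2 : R)] in
/-- **NON-VANISHING**: if some test function does not vanish at `0` (e.g. the indicator of a compact open neighbourhood), then `Φ ↦ (M Φ)(0)` is not
identically zero for any linear AUTOMORPHISM `M` (take `Φ = M⁻¹ f₀`). [cite: MoeglinVignerasWaldspurger1987, Chap. 2 II.6] -/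
theorem exists_apply_zero_ne_zero_of_equiv (M : SchwartzBruhat X ≃ₗ[ℂ] SchwartzBruhat X) (f₀ : SchwartzBruhat X) (h0 : (f₀ : X → ℂ) 0 ≠ 0) :
    ∃ f : SchwartzBruhat X, ((M f : SchwartzBruhat X) : X → ℂ) 0 ≠ 0 :=
  ⟨M.symm f₀, by rwa [LinearEquiv.apply_symm_apply]⟩

/-- the same for the operator of an implementer `p ∈ S̃p_ψ`. [cite: MoeglinVignerasWaldspurger1987, Chap. 2 II.6] -/
theorem exists_apply_zero_toRep_ne_zero (p : MpPsi (schrodingerSB β ψ hl hb)) (f₀ : SchwartzBruhat X) (h0 : (f₀ : X → ℂ) 0 ≠ 0) :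
    ∃ f : SchwartzBruhat X, ((MpPsi.toRep (schrodingerSB β ψ hl hb) p f : SchwartzBruhat X) : X → ℂ) 0 ≠ 0 := by
  obtain ⟨f, hf⟩ := exists_apply_zero_ne_zero_of_equiv ((p : symplecticGroup (polar β) × (SchwartzBruhat X ≃ₗ[ℂ] SchwartzBruhat X)).2) f₀ h0
  exact ⟨f, by rwa [MpPsi.toRep_apply]⟩

end Functional

end Literature.RepresentationTheory.HeisenbergGroup

end
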